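import Summits.CriticalPhenomena.SAWScalingLimit.Theses.SAWTrackTransport
import Summits.CriticalPhenomena.SAWScalingLimit.Theorems.SAWDevelopingMapHexTransferThirdBdryEndpoints
import Summits.CriticalPhenomena.SAWScalingLimit.Theorems.SAWCompassLatticeCompassSLEYbSubseqLimitChordal
import Summits.CriticalPhenomena.SAWScalingLimit.Theorems.SAWCompassLatticeCompassSLEYbCriterion
import Summits.CriticalPhenomena.SAWScalingLimit.Theorems.SAWWeldingIdentificationLimitUpgrade
import Literature.Probability.RandomPlanarGeometry.SLEConvergenceCriterion

/-!
# Line `avoidance` — a second registered skeleton for the crux `YBLimitExists`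
# (stmt-CriticalPhenomena-16995, route SAWTrackTransport; strategist line, `--alt` to `Lines/birth.lean`)

Crux (FIXED): (i) endpoint approximations at every angle `α ∈ [π/3, 2π/3]` (PROVED in tree,
`Cruxes.HexTransfer.YbRelay.ybEndpoints_of_mem_Icc`) ∧ (ii) a ROBUST FULL chordal scaling limit `P` of
Glazman–Manolescu's critical square-tiling (`Θ ≡ π/2`) Yang–Baxter walk: `∃ P, P.IsChordal ∧ RL (π/2) P`,
i.e. for every Dobrushin domain `D`, all sub-mesh shifts `u_δ` (`‖u_δ‖ ≤ δ`) and all admissible mid-edge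
endpoints, `ybLaw (π/2) (D + u_δ) δ 1 a_δ b_δ ∘ curve⁻¹ ⇒ P D` as `δ → 0⁺`. The limit is NOT identified.

## The idea (lens: TRANSFER at crux level — the value-free Lawler–Schramm–Werner restriction programme)

`Lines/birth.lean` cuts (ii) as Prokhorov: tightness + ONE monolithic stub `stub_subseqLimitUnique`
(robust uniqueness of unidentified subsequential limits), which carries the whole difficulty and for
which no technique is named. This line names the technique and cuts along it:

1. **Robustness is a lattice coupling, not a limit statement** (`stub_shiftEndpointCoupling`, NEW): any
   two admissible families `(u, a, b)`, `(u', a', b')` of the same Dobrushin domain are asymptotically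
   equal on bounded continuous test functions (the form of the route's own comparison cruxes
   `YBtoUniform`, `ArchTransport`, and of DKKMO's Thm 1.2 coupling). With it, EVERYTHING ELSE is only
   needed for CANONICAL families (`u ≡ 0`, `IsYBEndpointApprox` endpoints, carrier `D.carrier`), the
   families about which the tree already knows a lot (crux `CompassSLE`, stmt-6965, line `birth` v4).
2. **Uniqueness of the unidentified limit is transferred to SCALARS** (`stub_avoidanceCocycleLimit`, the
   load-bearing open stub): for a canonical family and every hull subdomain `D' ⊆ D` (same marked points,
   agreeing with `D` near them) the avoidance probability `P^{YB}_δ(range ⊆ closure D')` — by the EXACT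
   domain-restriction property of the product weight `w_Θ`, the ratio of Yang–Baxter partition functions
   `Z((D')_δ; a_δ, b_δ) / Z(D_δ; a_δ, b_δ)` up to one mesh layer — CONVERGES along the full filter
   `δ → 0⁺` to SOME `c ∈ [0, ∞]` (no value claimed). This is the `π/2`-Yang–Baxter twin of the grounded
   `δℤ²` item `SAWRestrictionRigidity.AvoidanceCocycleLimit` (stmt-1369) and the VALUE-FREE shadow of
   `CompassSLE`'s open stub I1 `stub_ybRestrictionLaw` (which asserts the limit `Φ'_A(0)^{5/8}`): strictly
   weaker than both identification and the crux's convergence of the full curve law, and a statement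
   about partition functions — the objects on which Yang–Baxter integrability acts (GM 2019 Thm 1:
   `G_Θ(a,b)` is `Θ`-invariant; the route's own track transport moves such ratios between tilings).
3. **Avoidance limits + simplicity pin subsequential limits WITHOUT identifying them**
   (`stub_uniqueOfAvoidance`, provable now): two probability subsequential limit laws of one canonical
   family, both carried by simple boundary-avoiding chords, give every hull-avoidance event the same mass
   (portmanteau sandwich, the argument of the LANDED `avoidancePassage_of_mass_zero_or_one` run with the
   SLE law replaced by the second subsequential limit) and are therefore EQUAL by the PROVED
   `AvoidanceDeterminesLaw_proof` (stmt-1373, LSW03 §3 "the law of K is determined by P[K ∩ A = ∅]").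
4. The carrier inputs of 3 are `stub_subseqLimitSimple` (= `CompassSLE`'s open I2b VERBATIM — shared, not
   new debt) and `stub_subseqLimitBoundary` (boundary avoidance; in `CompassSLE` it is derived from the SLE
   value, here it is value-free and owed — it is also clause (vi) of this route's `AxiomsOfLimit`);
   chordality is the LANDED `Theorems.SAWCompassLatticeCompassSLE.stub_ybSubseqLimitChordal`.
5. Precompactness of canonical families (`stub_canonicalTight` = `CompassSLE`'s statement `YBTight`
   verbatim; their T2 `traversal bound ⇒ tight` is LANDED, so the shared open input is the
   Aizenman–Burchard traversal bound T1), eventual probability of `ybLaw` (LANDED,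
   `eventually_isProbabilityMeasure_ybLaw`) and the abstract Billingsley criterion (LANDED,
   `Theorems.tendstoLaw_of_isTightAlongMesh_of_eventually`) then give convergence of every canonical
   family to the classically CHOSEN limit `limitFamily D`; the coupling 1 transports it to every
   admissible family. `YBLimitExists_of` below is that composition, kernel-checked, no `sorry` of its own.

Stubs (the ONLY `sorry`s): S1 `stub_canonicalTight` (OPEN, shared with CompassSLE T), S2
`stub_shiftEndpointCoupling` (OPEN, new, L), S3 `stub_avoidanceCocycleLimit` (OPEN, new here, the hardest),
S4 `stub_subseqLimitSimple` (OPEN, shared with CompassSLE I2b), S5 `stub_subseqLimitBoundary` (OPEN, L),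
S6 `stub_uniqueOfAvoidance` (provable now, L). All six are consumed by `YBLimitExists_of`.

Disproof used: none exists for this crux (`ledger crux ls stmt-CriticalPhenomena-16995`: Lines/birth only;
no `Theorems/YBLimitExists/Negative/`). Negatives honoured: stmt-0772 (all-`δ` `IsTightLaws`) — S1 is the
eventual `IsTightAlongMesh`; no stub quantifies over all `δ ∈ (0, 1]`.
-/

noncomputable section

open MeasureTheory Filter Topology Set
open scoped NNReal ENNReal BoundedContinuousFunction
open Literature.Probability.RandomPlanarGeometry
open Literature.Probability.RandomPlanarGeometry.SAW.YangBaxter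

namespace Summit.CriticalPhenomena.SAWScalingLimit.Cruxes.YBLimitExists.Avoidance

/-! ### The six statements, named (documentation; each stub below restates its body verbatim) -/

/-- **S1.** Tightness along the mesh of every CANONICAL family (verbatim `CompassSLE.Birth.YBTight`). -/
def CanonicalTight : Prop :=
  ∀ (D : DobrushinDomain) (a b : ℝ → MidEdge),
    IsYBEndpointApprox (fun (_ : ℤ) => Real.pi / 2) D a b →
    IsTightAlongMesh
      (fun δ (γ : YangBaxterSAW (fun (_ : ℤ) => Real.pi / 2) D.carrier δ (a δ) (b δ)) =>
        γ.curve (fun (_ : ℤ) => Real.pi / 2) δ)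
      (fun δ => ybLaw (fun (_ : ℤ) => Real.pi / 2) D.carrier δ 1 (a δ) (b δ))

/-- **S2.** Sub-mesh-shift / endpoint coupling: two admissible families of one Dobrushin domain are
asymptotically equal on bounded continuous test functions. -/
def ShiftEndpointCoupling : Prop :=
  ∀ (D : DobrushinDomain) (u u' : ℝ → ℂ) (a b a' b' : ℝ → MidEdge),
    (∀ᶠ δ in 𝓝[>] (0 : ℝ), ‖u δ‖ ≤ δ) →
    (∀ᶠ δ in 𝓝[>] (0 : ℝ), Nonempty (YangBaxterSAW (fun (_ : ℤ) => Real.pi / 2) ((D.map (similarity 1 one_ne_zero (u δ))).carrier) δ (a δ) (b δ))) →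
    Tendsto (fun δ : ℝ => (δ : ℂ) * planeMidpoint (fun (_ : ℤ) => Real.pi / 2) (a δ)) (𝓝[>] (0 : ℝ)) (𝓝 (D.pt 0)) →
    Tendsto (fun δ : ℝ => (δ : ℂ) * planeMidpoint (fun (_ : ℤ) => Real.pi / 2) (b δ)) (𝓝[>] (0 : ℝ)) (𝓝 (D.pt 1)) →
    (∀ᶠ δ in 𝓝[>] (0 : ℝ), ‖u' δ‖ ≤ δ) →
    (∀ᶠ δ in 𝓝[>] (0 : ℝ), Nonempty (YangBaxterSAW (fun (_ : ℤ) => Real.pi / 2) ((D.map (similarity 1 one_ne_zero (u' δ))).carrier) δ (a' δ) (b' δ))) →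
    Tendsto (fun δ : ℝ => (δ : ℂ) * planeMidpoint (fun (_ : ℤ) => Real.pi / 2) (a' δ)) (𝓝[>] (0 : ℝ)) (𝓝 (D.pt 0)) →
    Tendsto (fun δ : ℝ => (δ : ℂ) * planeMidpoint (fun (_ : ℤ) => Real.pi / 2) (b' δ)) (𝓝[>] (0 : ℝ)) (𝓝 (D.pt 1)) →
    ∀ f : BoundedContinuousFunction (CurveClass ℂ) ℝ,
      Tendsto (fun δ : ℝ =>
        (∫ γ, f (γ.curve (fun (_ : ℤ) => Real.pi / 2) δ)
            ∂(ybLaw (fun (_ : ℤ) => Real.pi / 2) ((D.map (similarity 1 one_ne_zero (u δ))).carrier) δ 1 (a δ) (b δ))) -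
          ∫ γ, f (γ.curve (fun (_ : ℤ) => Real.pi / 2) δ)
            ∂(ybLaw (fun (_ : ℤ) => Real.pi / 2) ((D.map (similarity 1 one_ne_zero (u' δ))).carrier) δ 1 (a' δ) (b' δ)))
        (𝓝[>] (0 : ℝ)) (𝓝 0)

/-- **S3.** The value-free avoidance cocycle limit of canonical families. -/
def AvoidanceCocycleLimit : Prop :=
  ∀ (D : DobrushinDomain) (a b : ℝ → MidEdge),
    IsYBEndpointApprox (fun (_ : ℤ) => Real.pi / 2) D a b →
    ∀ D' : DobrushinDomain, D'.carrier ⊆ D.carrier → D'.pt 0 = D.pt 0 → D'.pt 1 = D.pt 1 →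
      (∃ ε : ℝ, 0 < ε ∧ D'.carrier ∩ Metric.ball (D.pt 0) ε = D.carrier ∩ Metric.ball (D.pt 0) ε ∧
        D'.carrier ∩ Metric.ball (D.pt 1) ε = D.carrier ∩ Metric.ball (D.pt 1) ε) →
      ∃ c : ℝ≥0∞, Tendsto (fun δ : ℝ =>
          ((ybLaw (fun (_ : ℤ) => Real.pi / 2) D.carrier δ 1 (a δ) (b δ)).map
            (fun γ => γ.curve (fun (_ : ℤ) => Real.pi / 2) δ))
            (CurveClass.rangeSubset (closure D'.carrier)))
        (𝓝[>] (0 : ℝ)) (𝓝 c)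

/-- **S4.** Subsequential limit laws of canonical families are carried by simple curves (verbatim
`CompassSLE.Birth.stub_ybSubseqLimitSimple`). -/
def SubseqLimitSimple : Prop :=
  ∀ (D : DobrushinDomain) (a b : ℝ → MidEdge),
    IsYBEndpointApprox (fun (_ : ℤ) => Real.pi / 2) D a b →
    ∀ (s : ℕ → ℝ) (ν : Measure (CurveClass ℂ)), Tendsto s atTop (𝓝[>] (0 : ℝ)) →
      IsProbabilityMeasure ν →
      (∀ f : BoundedContinuousFunction (CurveClass ℂ) ℝ,
        Tendsto (fun n => ∫ γ, f (γ.curve (fun (_ : ℤ) => Real.pi / 2) (s n))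
            ∂(ybLaw (fun (_ : ℤ) => Real.pi / 2) D.carrier (s n) 1 (a (s n)) (b (s n))))
          atTop (𝓝 (∫ x, f x ∂ν))) →
      ∀ᵐ γ ∂ν, γ ∈ CurveClass.simple

/-- **S5.** Subsequential limit laws of canonical families meet `∂D` only at the marked points. -/
def SubseqLimitBoundary : Prop :=
  ∀ (D : DobrushinDomain) (a b : ℝ → MidEdge),
    IsYBEndpointApprox (fun (_ : ℤ) => Real.pi / 2) D a b →
    ∀ (s : ℕ → ℝ) (ν : Measure (CurveClass ℂ)), Tendsto s atTop (𝓝[>] (0 : ℝ)) →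
      IsProbabilityMeasure ν →
      (∀ f : BoundedContinuousFunction (CurveClass ℂ) ℝ,
        Tendsto (fun n => ∫ γ, f (γ.curve (fun (_ : ℤ) => Real.pi / 2) (s n))
            ∂(ybLaw (fun (_ : ℤ) => Real.pi / 2) D.carrier (s n) 1 (a (s n)) (b (s n))))
          atTop (𝓝 (∫ x, f x ∂ν))) →
      ∀ᵐ γ ∂ν, γ.range ∩ frontier D.carrier ⊆ {D.pt 0, D.pt 1}

/-- **S6.** Avoidance limits pin subsequential limits: two probability subsequential limit laws of ONE
canonical family whose avoidance cocycles converge along the full filter, both carried by simple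
boundary-avoiding chords, are equal. -/
def UniqueOfAvoidance : Prop :=
  ∀ (D : DobrushinDomain) (a b : ℝ → MidEdge),
    IsYBEndpointApprox (fun (_ : ℤ) => Real.pi / 2) D a b →
    (∀ D' : DobrushinDomain, D'.carrier ⊆ D.carrier → D'.pt 0 = D.pt 0 → D'.pt 1 = D.pt 1 →
      (∃ ε : ℝ, 0 < ε ∧ D'.carrier ∩ Metric.ball (D.pt 0) ε = D.carrier ∩ Metric.ball (D.pt 0) ε ∧
        D'.carrier ∩ Metric.ball (D.pt 1) ε = D.carrier ∩ Metric.ball (D.pt 1) ε) →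
      ∃ c : ℝ≥0∞, Tendsto (fun δ : ℝ =>
          ((ybLaw (fun (_ : ℤ) => Real.pi / 2) D.carrier δ 1 (a δ) (b δ)).map
            (fun γ => γ.curve (fun (_ : ℤ) => Real.pi / 2) δ))
            (CurveClass.rangeSubset (closure D'.carrier)))
        (𝓝[>] (0 : ℝ)) (𝓝 c)) →
    ∀ (s s' : ℕ → ℝ) (μ μ' : Measure (CurveClass ℂ)),
      Tendsto s atTop (𝓝[>] (0 : ℝ)) → Tendsto s' atTop (𝓝[>] (0 : ℝ)) →
      IsProbabilityMeasure μ → IsProbabilityMeasure μ' →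
      (∀ f : BoundedContinuousFunction (CurveClass ℂ) ℝ,
        Tendsto (fun n => ∫ γ, f (γ.curve (fun (_ : ℤ) => Real.pi / 2) (s n))
            ∂(ybLaw (fun (_ : ℤ) => Real.pi / 2) D.carrier (s n) 1 (a (s n)) (b (s n))))
          atTop (𝓝 (∫ x, f x ∂μ))) →
      (∀ f : BoundedContinuousFunction (CurveClass ℂ) ℝ,
        Tendsto (fun n => ∫ γ, f (γ.curve (fun (_ : ℤ) => Real.pi / 2) (s' n))
            ∂(ybLaw (fun (_ : ℤ) => Real.pi / 2) D.carrier (s' n) 1 (a (s' n)) (b (s' n))))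
          atTop (𝓝 (∫ x, f x ∂μ'))) →
      (∀ᵐ γ ∂μ, γ ∈ CurveClass.simple ∧ γ.source = D.pt 0 ∧ γ.target = D.pt 1 ∧
        γ.range ⊆ closure D.carrier ∧ γ.range ∩ frontier D.carrier ⊆ {D.pt 0, D.pt 1}) →
      (∀ᵐ γ ∂μ', γ ∈ CurveClass.simple ∧ γ.source = D.pt 0 ∧ γ.target = D.pt 1 ∧
        γ.range ⊆ closure D.carrier ∧ γ.range ∩ frontier D.carrier ⊆ {D.pt 0, D.pt 1}) →
      μ = μ'

/-! ### The stubs (the ONLY `sorry`s of this file; tree vocabulary only) -/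

/-- **S1 — precompactness of canonical families (OPEN; shared with crux `CompassSLE`).** For every
Dobrushin domain and every `π/2` endpoint approximation, the laws of the drawn critical Yang–Baxter
walks of `D_δ` are tight along the mesh filter. Literally `CompassSLE.Birth.YBTight`, whose registered
open input is the Aizenman–Burchard traversal bound T1 (`stub_ybTraversalBound`; T2 `traversal bound ⇒
tight` is LANDED, `Theorems/SAWCompassLatticeCompassSLEYbTightOfTraversalBound.lean`). Why open: no
annulus-crossing bound is known for any critical SAW-type model (no FKG/RSW at n = 0; inputs in tree:
bridge decay `GlazmanManolescu2019_thm2_holds`, sub-ballisticity). -/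
theorem stub_canonicalTight :
    ∀ (D : DobrushinDomain) (a b : ℝ → MidEdge),
      IsYBEndpointApprox (fun (_ : ℤ) => Real.pi / 2) D a b →
      IsTightAlongMesh
        (fun δ (γ : YangBaxterSAW (fun (_ : ℤ) => Real.pi / 2) D.carrier δ (a δ) (b δ)) =>
          γ.curve (fun (_ : ℤ) => Real.pi / 2) δ)
        (fun δ => ybLaw (fun (_ : ℤ) => Real.pi / 2) D.carrier δ 1 (a δ) (b δ)) := by
  sorry

/-- **S2 — sub-mesh-shift / endpoint coupling (OPEN, L; the route-specific robustness, limit-free).**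
For one Dobrushin domain `D` and ANY TWO admissible families — sub-mesh shifts `u, u'` (`‖u δ‖, ‖u' δ‖ ≤ δ`
eventually), mid-edge endpoints joined in `(D + u δ)_δ`, resp. `(D + u' δ)_δ`, with rescaled midpoints
tending to the marked points — the two critical `π/2` Yang–Baxter curve laws are asymptotically equal on
every bounded continuous test function. Lattice mechanism: exact restriction of the product weight (both
families are conditionings of the law in `(D ∪ (D + u δ))`-type common super-domains) + a Kesten-type
coupling of the walks near the marked points (cf. the `δℤ²` item `SAWCircleScreening.EndpointCoupling`,
stmt-5465, and Kennedy–Lawler arXiv:1109.3091: lattice effects enter only the normalisation); the shift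
part is "the walk does not feel a one-mesh perturbation of `∂D` away from `a, b`". Why it might fail:
boundary-hugging near rough prime ends; a limit law depending on the germ of `∂D_δ` at `a` would refute
the crux itself (and the summit as typed). -/
theorem stub_shiftEndpointCoupling :
    ∀ (D : DobrushinDomain) (u u' : ℝ → ℂ) (a b a' b' : ℝ → MidEdge),
      (∀ᶠ δ in 𝓝[>] (0 : ℝ), ‖u δ‖ ≤ δ) →
      (∀ᶠ δ in 𝓝[>] (0 : ℝ), Nonempty (YangBaxterSAW (fun (_ : ℤ) => Real.pi / 2) ((D.map (similarity 1 one_ne_zero (u δ))).carrier) δ (a δ) (b δ))) →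
      Tendsto (fun δ : ℝ => (δ : ℂ) * planeMidpoint (fun (_ : ℤ) => Real.pi / 2) (a δ)) (𝓝[>] (0 : ℝ)) (𝓝 (D.pt 0)) →
      Tendsto (fun δ : ℝ => (δ : ℂ) * planeMidpoint (fun (_ : ℤ) => Real.pi / 2) (b δ)) (𝓝[>] (0 : ℝ)) (𝓝 (D.pt 1)) →
      (∀ᶠ δ in 𝓝[>] (0 : ℝ), ‖u' δ‖ ≤ δ) →
      (∀ᶠ δ in 𝓝[>] (0 : ℝ), Nonempty (YangBaxterSAW (fun (_ : ℤ) => Real.pi / 2) ((D.map (similarity 1 one_ne_zero (u' δ))).carrier) δ (a' δ) (b' δ))) →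
      Tendsto (fun δ : ℝ => (δ : ℂ) * planeMidpoint (fun (_ : ℤ) => Real.pi / 2) (a' δ)) (𝓝[>] (0 : ℝ)) (𝓝 (D.pt 0)) →
      Tendsto (fun δ : ℝ => (δ : ℂ) * planeMidpoint (fun (_ : ℤ) => Real.pi / 2) (b' δ)) (𝓝[>] (0 : ℝ)) (𝓝 (D.pt 1)) →
      ∀ f : BoundedContinuousFunction (CurveClass ℂ) ℝ,
        Tendsto (fun δ : ℝ =>
          (∫ γ, f (γ.curve (fun (_ : ℤ) => Real.pi / 2) δ)
              ∂(ybLaw (fun (_ : ℤ) => Real.pi / 2) ((D.map (similarity 1 one_ne_zero (u δ))).carrier) δ 1 (a δ) (b δ))) -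
            ∫ γ, f (γ.curve (fun (_ : ℤ) => Real.pi / 2) δ)
              ∂(ybLaw (fun (_ : ℤ) => Real.pi / 2) ((D.map (similarity 1 one_ne_zero (u' δ))).carrier) δ 1 (a' δ) (b' δ)))
          (𝓝[>] (0 : ℝ)) (𝓝 0) := by
  sorry

/-- **S3 — the value-free avoidance cocycle limit (OPEN; the load-bearing stub of the line).** For a
canonical family and every hull subdomain `D' ⊆ D` (same marked points, equal to `D` near them), the
avoidance probability `P^{YB}_δ(range ⊆ closure D')` converges as `δ → 0⁺` along the FULL filter to some
`c` (no claim on the value; LSW04 §3.4.5/§4.1 predict a conformal quantity to the power `5/8`). Lattice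
meaning: the GM weight is a product of local face weights, so the law restricted to walks of `(D')_δ` IS
the law of `(D')_δ` (`YBWalk.mapDomain`, `weight_mapDomain`), and the statement is convergence of the
partition-function ratio `Z((D')_δ)/Z(D_δ)` up to one mesh layer at `∂D'`. `π/2`-twin of the `δℤ²` item
`SAWRestrictionRigidity.AvoidanceCocycleLimit` (stmt-1369); value-free shadow of `CompassSLE`'s I1. Why
it might fail: a full-filter limit of a ratio of critical partition functions with no monotonicity in `δ`;
continuity-set/touching pathologies for `D'` with inward cusps. -/
theorem stub_avoidanceCocycleLimit :
    ∀ (D : DobrushinDomain) (a b : ℝ → MidEdge),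
      IsYBEndpointApprox (fun (_ : ℤ) => Real.pi / 2) D a b →
      ∀ D' : DobrushinDomain, D'.carrier ⊆ D.carrier → D'.pt 0 = D.pt 0 → D'.pt 1 = D.pt 1 →
        (∃ ε : ℝ, 0 < ε ∧ D'.carrier ∩ Metric.ball (D.pt 0) ε = D.carrier ∩ Metric.ball (D.pt 0) ε ∧
          D'.carrier ∩ Metric.ball (D.pt 1) ε = D.carrier ∩ Metric.ball (D.pt 1) ε) →
        ∃ c : ℝ≥0∞, Tendsto (fun δ : ℝ =>
            ((ybLaw (fun (_ : ℤ) => Real.pi / 2) D.carrier δ 1 (a δ) (b δ)).map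
              (fun γ => γ.curve (fun (_ : ℤ) => Real.pi / 2) δ))
              (CurveClass.rangeSubset (closure D'.carrier)))
          (𝓝[>] (0 : ℝ)) (𝓝 c) := by
  sorry

/-- **S4 — subsequential limits are simple (OPEN; shared verbatim with `CompassSLE`'s I2b).** A uniform
no-macroscopic-near-self-touching estimate for the critical `π/2` Yang–Baxter walk; `CurveClass.simple`
is not closed, nothing soft gives it. -/
theorem stub_subseqLimitSimple :
    ∀ (D : DobrushinDomain) (a b : ℝ → MidEdge),
      IsYBEndpointApprox (fun (_ : ℤ) => Real.pi / 2) D a b →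
      ∀ (s : ℕ → ℝ) (ν : Measure (CurveClass ℂ)), Tendsto s atTop (𝓝[>] (0 : ℝ)) →
        IsProbabilityMeasure ν →
        (∀ f : BoundedContinuousFunction (CurveClass ℂ) ℝ,
          Tendsto (fun n => ∫ γ, f (γ.curve (fun (_ : ℤ) => Real.pi / 2) (s n))
              ∂(ybLaw (fun (_ : ℤ) => Real.pi / 2) D.carrier (s n) 1 (a (s n)) (b (s n))))
            atTop (𝓝 (∫ x, f x ∂ν))) →
        ∀ᵐ γ ∂ν, γ ∈ CurveClass.simple := by
  sorry

/-- **S5 — subsequential limits avoid the boundary (OPEN, L).** `ν`-a.e. curve class meets `frontier D`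
only inside `{a, b}`: a uniform no-boundary-crawling estimate (in `CompassSLE` this clause is derived from
the SLE avoidance values; value-free it is owed — it is also clause (vi) of this route's `AxiomsOfLimit`
at the subsequential level). Lattice heuristic (LSW04 §3.4.5): continuity of the partition function under
shrinking `D` away from `a, b`. -/
theorem stub_subseqLimitBoundary :
    ∀ (D : DobrushinDomain) (a b : ℝ → MidEdge),
      IsYBEndpointApprox (fun (_ : ℤ) => Real.pi / 2) D a b →
      ∀ (s : ℕ → ℝ) (ν : Measure (CurveClass ℂ)), Tendsto s atTop (𝓝[>] (0 : ℝ)) →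
        IsProbabilityMeasure ν →
        (∀ f : BoundedContinuousFunction (CurveClass ℂ) ℝ,
          Tendsto (fun n => ∫ γ, f (γ.curve (fun (_ : ℤ) => Real.pi / 2) (s n))
              ∂(ybLaw (fun (_ : ℤ) => Real.pi / 2) D.carrier (s n) 1 (a (s n)) (b (s n))))
            atTop (𝓝 (∫ x, f x ∂ν))) →
        ∀ᵐ γ ∂ν, γ.range ∩ frontier D.carrier ⊆ {D.pt 0, D.pt 1} := by
  sorry

/-- **S6 — avoidance limits pin subsequential limits (provable now, L).** Two probability subsequential
limit laws `μ, μ'` (along mesh sequences `s, s'`) of ONE canonical family whose hull-avoidance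
probabilities converge along the full filter, both carried by simple chords of `D̄` from `a` to `b` meeting
`∂D` only at `a, b`, are equal. Proof route: for each hull subdomain `D'`, `c(D') ≤ μ(F)` by portmanteau on
the closed `F = rangeSubset (closure D')`, and `μ(F) ≤ inf_k c(D''_k) ≤ μ'(F)` by the super-domain sandwich
of the LANDED `Theorems/SAWCompassLatticeCompassSLEYbAvoidancePassage.lean`
(`AvoidancePassage.exists_superdomain`; boundary avoidance of `μ'` replaces the SLE carrier in the step
`μ'(F_k) ↓ μ'(F)`); symmetry gives equality on every hull-avoidance event, and the PROVED
`Theorems.AvoidanceDeterminesLaw.AvoidanceDeterminesLaw_proof` (stmt-1373) gives `μ = μ'`. -/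
theorem stub_uniqueOfAvoidance :
    ∀ (D : DobrushinDomain) (a b : ℝ → MidEdge),
      IsYBEndpointApprox (fun (_ : ℤ) => Real.pi / 2) D a b →
      (∀ D' : DobrushinDomain, D'.carrier ⊆ D.carrier → D'.pt 0 = D.pt 0 → D'.pt 1 = D.pt 1 →
        (∃ ε : ℝ, 0 < ε ∧ D'.carrier ∩ Metric.ball (D.pt 0) ε = D.carrier ∩ Metric.ball (D.pt 0) ε ∧
          D'.carrier ∩ Metric.ball (D.pt 1) ε = D.carrier ∩ Metric.ball (D.pt 1) ε) →
        ∃ c : ℝ≥0∞, Tendsto (fun δ : ℝ =>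
            ((ybLaw (fun (_ : ℤ) => Real.pi / 2) D.carrier δ 1 (a δ) (b δ)).map
              (fun γ => γ.curve (fun (_ : ℤ) => Real.pi / 2) δ))
              (CurveClass.rangeSubset (closure D'.carrier)))
          (𝓝[>] (0 : ℝ)) (𝓝 c)) →
      ∀ (s s' : ℕ → ℝ) (μ μ' : Measure (CurveClass ℂ)),
        Tendsto s atTop (𝓝[>] (0 : ℝ)) → Tendsto s' atTop (𝓝[>] (0 : ℝ)) →
        IsProbabilityMeasure μ → IsProbabilityMeasure μ' →
        (∀ f : BoundedContinuousFunction (CurveClass ℂ) ℝ,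
          Tendsto (fun n => ∫ γ, f (γ.curve (fun (_ : ℤ) => Real.pi / 2) (s n))
              ∂(ybLaw (fun (_ : ℤ) => Real.pi / 2) D.carrier (s n) 1 (a (s n)) (b (s n))))
            atTop (𝓝 (∫ x, f x ∂μ))) →
        (∀ f : BoundedContinuousFunction (CurveClass ℂ) ℝ,
          Tendsto (fun n => ∫ γ, f (γ.curve (fun (_ : ℤ) => Real.pi / 2) (s' n))
              ∂(ybLaw (fun (_ : ℤ) => Real.pi / 2) D.carrier (s' n) 1 (a (s' n)) (b (s' n))))
            atTop (𝓝 (∫ x, f x ∂μ'))) →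
        (∀ᵐ γ ∂μ, γ ∈ CurveClass.simple ∧ γ.source = D.pt 0 ∧ γ.target = D.pt 1 ∧
          γ.range ⊆ closure D.carrier ∧ γ.range ∩ frontier D.carrier ⊆ {D.pt 0, D.pt 1}) →
        (∀ᵐ γ ∂μ', γ ∈ CurveClass.simple ∧ γ.source = D.pt 0 ∧ γ.target = D.pt 1 ∧
          γ.range ⊆ closure D.carrier ∧ γ.range ∩ frontier D.carrier ⊆ {D.pt 0, D.pt 1}) →
        μ = μ' := by
  sorry

/-! ### Consistency: each named statement IS its stub (definitionally) -/

theorem canonicalTight_holds : CanonicalTight := stub_canonicalTight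
theorem shiftEndpointCoupling_holds : ShiftEndpointCoupling := stub_shiftEndpointCoupling
theorem avoidanceCocycleLimit_holds : AvoidanceCocycleLimit := stub_avoidanceCocycleLimit
theorem subseqLimitSimple_holds : SubseqLimitSimple := stub_subseqLimitSimple
theorem subseqLimitBoundary_holds : SubseqLimitBoundary := stub_subseqLimitBoundary
theorem uniqueOfAvoidance_holds : UniqueOfAvoidance := stub_uniqueOfAvoidance

/-! ### Name-keyed aliases — the hypotheses of `YBLimitExists_of` (device of `Lines/birth.lean`) -/
namespace __Registered

/-- Alias of `CanonicalTight` keyed by the registered stub name. -/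
abbrev stub_canonicalTight : Prop := CanonicalTight
/-- Alias of `ShiftEndpointCoupling` keyed by the registered stub name. -/
abbrev stub_shiftEndpointCoupling : Prop := ShiftEndpointCoupling
/-- Alias of `AvoidanceCocycleLimit` keyed by the registered stub name. -/
abbrev stub_avoidanceCocycleLimit : Prop := AvoidanceCocycleLimit
/-- Alias of `SubseqLimitSimple` keyed by the registered stub name. -/
abbrev stub_subseqLimitSimple : Prop := SubseqLimitSimple
/-- Alias of `SubseqLimitBoundary` keyed by the registered stub name. -/
abbrev stub_subseqLimitBoundary : Prop := SubseqLimitBoundary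
/-- Alias of `UniqueOfAvoidance` keyed by the registered stub name. -/
abbrev stub_uniqueOfAvoidance : Prop := UniqueOfAvoidance

end __Registered

/-! ### First lemma of the line (provable now, proved): exact restriction of the face walk

The lattice fact behind S3: a walk of the smaller domain is a walk of the larger one (`YBWalk.mapDomain`,
injective, `mapDomain_injective`) with the SAME weight (`YBWalk.weight_mapDomain`, `rfl`) and the SAME drawn
curve (`curve_mapDomain` below, `rfl`), so the avoidance mass `ybWeight (π/2) D δ 1 a b {γ | γ uses only
faces of (D')_δ}` equals the partition function `Z((D')_δ; a, b)` and avoidance probabilities are ratios of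
Yang–Baxter partition functions — the objects GM 2019 Thm 1 and the route's track transport act on. -/

/-- Enlarging the ambient face set does not change the drawn curve. -/
theorem curve_mapDomain {Δ Δ' : Set Face} (h : Δ ⊆ Δ') {a z : MidEdge} (Θ : ℤ → ℝ) (δ : ℝ)
    (γ : YBWalk Δ a z) : (γ.mapDomain h).curve Θ δ = γ.curve Θ δ := rfl

/-! ### Glue: transport along propositional equalities of the carrier function -/

section Transport

variable {Ω Ω' : ℝ → Set ℂ} {a b : ℝ → MidEdge}

/-- Eventual non-emptiness of the walk sets, transported along `Ω = Ω'`. -/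
theorem nonempty_transport (h : Ω = Ω')
    (hne : ∀ᶠ δ in 𝓝[>] (0 : ℝ), Nonempty (YangBaxterSAW (fun (_ : ℤ) => Real.pi / 2) (Ω δ) δ (a δ) (b δ))) :
    ∀ᶠ δ in 𝓝[>] (0 : ℝ), Nonempty (YangBaxterSAW (fun (_ : ℤ) => Real.pi / 2) (Ω' δ) δ (a δ) (b δ)) := by
  subst h; exact hne

/-- Convergence in law along the mesh filter, transported along `Ω = Ω'`. -/
theorem tendstoLaw_transport (h : Ω = Ω') {ν : Measure (CurveClass ℂ)}
    (hT : TendstoLaw (fun δ (γ : YangBaxterSAW (fun (_ : ℤ) => Real.pi / 2) (Ω δ) δ (a δ) (b δ)) =>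
        γ.curve (fun (_ : ℤ) => Real.pi / 2) δ)
      (fun δ => ybLaw (fun (_ : ℤ) => Real.pi / 2) (Ω δ) δ 1 (a δ) (b δ)) id ν) :
    TendstoLaw (fun δ (γ : YangBaxterSAW (fun (_ : ℤ) => Real.pi / 2) (Ω' δ) δ (a δ) (b δ)) =>
        γ.curve (fun (_ : ℤ) => Real.pi / 2) δ)
      (fun δ => ybLaw (fun (_ : ℤ) => Real.pi / 2) (Ω' δ) δ 1 (a δ) (b δ)) id ν := by
  subst h; exact hT

/-- An asymptotic-equality statement between two families, with the SECOND carrier transported. -/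
theorem diff_transport_right {Ω₁ Ω₂ Ω₂' : ℝ → Set ℂ} (h : Ω₂ = Ω₂') {a₁ b₁ a₂ b₂ : ℝ → MidEdge}
    (hd : ∀ f : BoundedContinuousFunction (CurveClass ℂ) ℝ,
      Tendsto (fun δ : ℝ =>
        (∫ γ, f (γ.curve (fun (_ : ℤ) => Real.pi / 2) δ)
            ∂(ybLaw (fun (_ : ℤ) => Real.pi / 2) (Ω₁ δ) δ 1 (a₁ δ) (b₁ δ))) -
          ∫ γ, f (γ.curve (fun (_ : ℤ) => Real.pi / 2) δ)
            ∂(ybLaw (fun (_ : ℤ) => Real.pi / 2) (Ω₂ δ) δ 1 (a₂ δ) (b₂ δ)))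
        (𝓝[>] (0 : ℝ)) (𝓝 0)) :
    ∀ f : BoundedContinuousFunction (CurveClass ℂ) ℝ,
      Tendsto (fun δ : ℝ =>
        (∫ γ, f (γ.curve (fun (_ : ℤ) => Real.pi / 2) δ)
            ∂(ybLaw (fun (_ : ℤ) => Real.pi / 2) (Ω₁ δ) δ 1 (a₁ δ) (b₁ δ))) -
          ∫ γ, f (γ.curve (fun (_ : ℤ) => Real.pi / 2) δ)
            ∂(ybLaw (fun (_ : ℤ) => Real.pi / 2) (Ω₂' δ) δ 1 (a₂ δ) (b₂ δ)))
        (𝓝[>] (0 : ℝ)) (𝓝 0) := by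
  subst h; exact hd

/-- An asymptotic-equality statement between two families, with the FIRST carrier transported. -/
theorem diff_transport_left {Ω₁ Ω₁' Ω₂ : ℝ → Set ℂ} (h : Ω₁ = Ω₁') {a₁ b₁ a₂ b₂ : ℝ → MidEdge}
    (hd : ∀ f : BoundedContinuousFunction (CurveClass ℂ) ℝ,
      Tendsto (fun δ : ℝ =>
        (∫ γ, f (γ.curve (fun (_ : ℤ) => Real.pi / 2) δ)
            ∂(ybLaw (fun (_ : ℤ) => Real.pi / 2) (Ω₁ δ) δ 1 (a₁ δ) (b₁ δ))) -
          ∫ γ, f (γ.curve (fun (_ : ℤ) => Real.pi / 2) δ)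
            ∂(ybLaw (fun (_ : ℤ) => Real.pi / 2) (Ω₂ δ) δ 1 (a₂ δ) (b₂ δ)))
        (𝓝[>] (0 : ℝ)) (𝓝 0)) :
    ∀ f : BoundedContinuousFunction (CurveClass ℂ) ℝ,
      Tendsto (fun δ : ℝ =>
        (∫ γ, f (γ.curve (fun (_ : ℤ) => Real.pi / 2) δ)
            ∂(ybLaw (fun (_ : ℤ) => Real.pi / 2) (Ω₁' δ) δ 1 (a₁ δ) (b₁ δ))) -
          ∫ γ, f (γ.curve (fun (_ : ℤ) => Real.pi / 2) δ)
            ∂(ybLaw (fun (_ : ℤ) => Real.pi / 2) (Ω₂ δ) δ 1 (a₂ δ) (b₂ δ)))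
        (𝓝[>] (0 : ℝ)) (𝓝 0) := by
  subst h; exact hd

/-- **Weak limits ride the coupling**: if two families are asymptotically equal on bounded continuous
test functions along `𝓝[>] 0` and the first converges weakly to `μ` along a mesh sequence `s`, so does
the second. -/
theorem weak_of_diff {Ω₁ Ω₂ : ℝ → Set ℂ} {a₁ b₁ a₂ b₂ : ℝ → MidEdge} {s : ℕ → ℝ}
    (hs : Tendsto s atTop (𝓝[>] (0 : ℝ))) {μ : Measure (CurveClass ℂ)}
    (hd : ∀ f : BoundedContinuousFunction (CurveClass ℂ) ℝ,
      Tendsto (fun δ : ℝ =>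
        (∫ γ, f (γ.curve (fun (_ : ℤ) => Real.pi / 2) δ)
            ∂(ybLaw (fun (_ : ℤ) => Real.pi / 2) (Ω₁ δ) δ 1 (a₁ δ) (b₁ δ))) -
          ∫ γ, f (γ.curve (fun (_ : ℤ) => Real.pi / 2) δ)
            ∂(ybLaw (fun (_ : ℤ) => Real.pi / 2) (Ω₂ δ) δ 1 (a₂ δ) (b₂ δ)))
        (𝓝[>] (0 : ℝ)) (𝓝 0))
    (h₁ : ∀ f : BoundedContinuousFunction (CurveClass ℂ) ℝ,
      Tendsto (fun n => ∫ γ, f (γ.curve (fun (_ : ℤ) => Real.pi / 2) (s n))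
          ∂(ybLaw (fun (_ : ℤ) => Real.pi / 2) (Ω₁ (s n)) (s n) 1 (a₁ (s n)) (b₁ (s n))))
        atTop (𝓝 (∫ x, f x ∂μ))) :
    ∀ f : BoundedContinuousFunction (CurveClass ℂ) ℝ,
      Tendsto (fun n => ∫ γ, f (γ.curve (fun (_ : ℤ) => Real.pi / 2) (s n))
          ∂(ybLaw (fun (_ : ℤ) => Real.pi / 2) (Ω₂ (s n)) (s n) 1 (a₂ (s n)) (b₂ (s n))))
        atTop (𝓝 (∫ x, f x ∂μ)) := by
  intro f
  have h3 := (h₁ f).sub ((hd f).comp hs)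
  rw [sub_zero] at h3
  refine h3.congr fun n => ?_
  simp only [Function.comp_apply, sub_sub_cancel]

end Transport

/-- The sub-mesh shift `u ≡ 0` does not move the domain. -/
theorem carrier_shift_zero (D : DobrushinDomain) :
    (fun δ : ℝ => (D.map (similarity 1 one_ne_zero ((fun _ : ℝ => (0 : ℂ)) δ))).carrier) =
      fun _ : ℝ => D.carrier := by
  funext δ
  ext z
  simp [MarkedDomain.carrier_map]

/-- The shift `u ≡ 0` is an admissible sub-mesh shift. -/
theorem eventually_norm_zero_le : ∀ᶠ δ in 𝓝[>] (0 : ℝ), ‖(fun _ : ℝ => (0 : ℂ)) δ‖ ≤ δ := by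
  filter_upwards [self_mem_nhdsWithin] with δ hδ
  simpa using le_of_lt hδ

/-- `π/2` lies in Glazman–Manolescu's range `[π/3, 2π/3]`. -/
theorem pi_div_two_mem_Icc : Real.pi / 2 ∈ Set.Icc (Real.pi / 3) (2 * Real.pi / 3) := by
  constructor <;> nlinarith [Real.pi_pos]

/-! ### The limit family, by classical choice (canonical families only) -/

/-- `μ` is a probability subsequential limit law of SOME canonical family (`u ≡ 0`, `π/2` endpoint
approximation) of the Dobrushin domain `D`. -/
def IsCanonLimitLaw (D : DobrushinDomain) (μ : Measure (CurveClass ℂ)) : Prop :=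
  IsProbabilityMeasure μ ∧ ∃ (a b : ℝ → MidEdge), IsYBEndpointApprox (fun (_ : ℤ) => Real.pi / 2) D a b ∧
    ∃ s : ℕ → ℝ, Tendsto s atTop (𝓝[>] (0 : ℝ)) ∧
      ∀ f : BoundedContinuousFunction (CurveClass ℂ) ℝ,
        Tendsto (fun n => ∫ γ, f (γ.curve (fun (_ : ℤ) => Real.pi / 2) (s n))
            ∂(ybLaw (fun (_ : ℤ) => Real.pi / 2) D.carrier (s n) 1 (a (s n)) (b (s n))))
          atTop (𝓝 (∫ x, f x ∂μ))

open Classical in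
/-- **The candidate limit family**: where some canonical family of `D` has a probability subsequential
limit law, choose one; elsewhere the Dirac mass on the boundary arc (`ChordalFamily.arcFamily`). -/
def limitFamily : ChordalFamily := fun D =>
  if h : ∃ μ, IsCanonLimitLaw D μ then h.choose else ChordalFamily.arcFamily D

theorem isCanonLimitLaw_limitFamily {D : DobrushinDomain} (h : ∃ μ, IsCanonLimitLaw D μ) :
    IsCanonLimitLaw D (limitFamily D) := by
  classical
  have e : limitFamily D = h.choose := by simp only [limitFamily, dif_pos h]
  rw [e]
  exact h.choose_spec

theorem limitFamily_eq_arcFamily {D : DobrushinDomain} (h : ¬ ∃ μ, IsCanonLimitLaw D μ) :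
    limitFamily D = ChordalFamily.arcFamily D := by
  classical
  simp only [limitFamily, dif_neg h]

/-- `limitFamily` is chordal — NO stub needed: chordality of canonical subsequential limits is the LANDED
`Theorems.SAWCompassLatticeCompassSLE.stub_ybSubseqLimitChordal`. -/
theorem isChordal_limitFamily : limitFamily.IsChordal := by
  intro D
  rcases Classical.em (∃ μ, IsCanonLimitLaw D μ) with h | h
  · obtain ⟨hprob, a, b, hab, s, hs, hlim⟩ := isCanonLimitLaw_limitFamily h
    exact ⟨hprob, Summit.CriticalPhenomena.SAWScalingLimit.Theorems.SAWCompassLatticeCompassSLE.stub_ybSubseqLimitChordal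
      D a b hab s _ hs hprob hlim⟩
  · rw [limitFamily_eq_arcFamily h]
    exact ChordalFamily.isChordal_arcFamily D

/-- **Canonical families converge to `limitFamily D`** (uses S1, S2, S3, S4, S5, S6 and the LANDED
eventual probability of `ybLaw`, chordality of subsequential limits and Billingsley criterion). -/
theorem tendstoLaw_canonical (hT : CanonicalTight) (hC : ShiftEndpointCoupling) (hA : AvoidanceCocycleLimit)
    (hS : SubseqLimitSimple) (hB : SubseqLimitBoundary) (hU : UniqueOfAvoidance)
    (D : DobrushinDomain) {a₀ b₀ : ℝ → MidEdge}
    (happ₀ : IsYBEndpointApprox (fun (_ : ℤ) => Real.pi / 2) D a₀ b₀) :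
    TendstoLaw (fun δ (γ : YangBaxterSAW (fun (_ : ℤ) => Real.pi / 2) D.carrier δ (a₀ δ) (b₀ δ)) =>
        γ.curve (fun (_ : ℤ) => Real.pi / 2) δ)
      (fun δ => ybLaw (fun (_ : ℤ) => Real.pi / 2) D.carrier δ 1 (a₀ δ) (b₀ δ)) id (limitFamily D) := by
  refine Summit.CriticalPhenomena.SAWScalingLimit.Theorems.tendstoLaw_of_isTightAlongMesh_of_eventually
    (Summit.CriticalPhenomena.SAWScalingLimit.Theorems.SAWCompassLatticeCompassSLE.eventually_isProbabilityMeasure_ybLaw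
      D happ₀)
    (Eventually.of_forall fun δ => YBWalk.aemeasurable_curve _ _ _ _ _ _) (hT D a₀ b₀ happ₀) ?_
  intro P' hP' s hspos hs0 hlim
  -- the mesh sequence tends to `0` within `(0, ∞)`
  have hs : Tendsto s atTop (𝓝[>] (0 : ℝ)) :=
    tendsto_nhdsWithin_iff.2 ⟨hs0, Eventually.of_forall fun n => Set.mem_Ioi.2 (hspos n)⟩
  -- `P'` is a canonical limit law of `D`, so `limitFamily D` is a chosen canonical limit law `μ₁`
  have hex : ∃ μ, IsCanonLimitLaw D μ := ⟨P', hP', a₀, b₀, happ₀, s, hs, hlim⟩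
  obtain ⟨hprob₁, a₁, b₁, happ₁, s₁, hs₁, hlim₁⟩ := isCanonLimitLaw_limitFamily hex
  -- S2 between the canonical families `(a₁, b₁)` and `(a₀, b₀)` (both viewed with the shift `u ≡ 0`)
  have hcoup₀ := hC D (fun _ : ℝ => (0 : ℂ)) (fun _ : ℝ => (0 : ℂ)) a₁ b₁ a₀ b₀ eventually_norm_zero_le
    (nonempty_transport (carrier_shift_zero D).symm happ₁.nonempty) happ₁.tendsto_fst happ₁.tendsto_snd
    eventually_norm_zero_le (nonempty_transport (carrier_shift_zero D).symm happ₀.nonempty)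
    happ₀.tendsto_fst happ₀.tendsto_snd
  have hcoup : ∀ f : BoundedContinuousFunction (CurveClass ℂ) ℝ,
      Tendsto (fun δ : ℝ =>
        (∫ γ, f (γ.curve (fun (_ : ℤ) => Real.pi / 2) δ)
            ∂(ybLaw (fun (_ : ℤ) => Real.pi / 2) ((fun _ : ℝ => D.carrier) δ) δ 1 (a₁ δ) (b₁ δ))) -
          ∫ γ, f (γ.curve (fun (_ : ℤ) => Real.pi / 2) δ)
            ∂(ybLaw (fun (_ : ℤ) => Real.pi / 2) ((fun _ : ℝ => D.carrier) δ) δ 1 (a₀ δ) (b₀ δ)))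
        (𝓝[>] (0 : ℝ)) (𝓝 0) :=
    diff_transport_left (carrier_shift_zero D) (diff_transport_right (carrier_shift_zero D) hcoup₀)
  -- hence `μ₁ = limitFamily D` is also a subsequential limit law of the family `(a₀, b₀)`, along `s₁`
  have hlim₁' : ∀ f : BoundedContinuousFunction (CurveClass ℂ) ℝ,
      Tendsto (fun n => ∫ γ, f (γ.curve (fun (_ : ℤ) => Real.pi / 2) (s₁ n))
          ∂(ybLaw (fun (_ : ℤ) => Real.pi / 2) D.carrier (s₁ n) 1 (a₀ (s₁ n)) (b₀ (s₁ n))))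
        atTop (𝓝 (∫ x, f x ∂(limitFamily D))) :=
    weak_of_diff (Ω₁ := fun _ : ℝ => D.carrier) (Ω₂ := fun _ : ℝ => D.carrier) hs₁ hcoup hlim₁
  -- carriers of the two subsequential limit laws of the family `(a₀, b₀)`: chordal (LANDED), simple (S4),
  -- boundary-avoiding (S5)
  have hcarP' : ∀ᵐ γ ∂P', γ ∈ CurveClass.simple ∧ γ.source = D.pt 0 ∧ γ.target = D.pt 1 ∧
      γ.range ⊆ closure D.carrier ∧ γ.range ∩ frontier D.carrier ⊆ {D.pt 0, D.pt 1} := by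
    have h1 := Summit.CriticalPhenomena.SAWScalingLimit.Theorems.SAWCompassLatticeCompassSLE.stub_ybSubseqLimitChordal
      D a₀ b₀ happ₀ s P' hs hP' hlim
    have h2 := hS D a₀ b₀ happ₀ s P' hs hP' hlim
    have h3 := hB D a₀ b₀ happ₀ s P' hs hP' hlim
    filter_upwards [h1, h2, h3] with γ h1 h2 h3
    exact ⟨h2, h1.1, h1.2.1, h1.2.2, h3⟩
  have hcar₁ : ∀ᵐ γ ∂(limitFamily D), γ ∈ CurveClass.simple ∧ γ.source = D.pt 0 ∧ γ.target = D.pt 1 ∧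
      γ.range ⊆ closure D.carrier ∧ γ.range ∩ frontier D.carrier ⊆ {D.pt 0, D.pt 1} := by
    have h1 := Summit.CriticalPhenomena.SAWScalingLimit.Theorems.SAWCompassLatticeCompassSLE.stub_ybSubseqLimitChordal
      D a₀ b₀ happ₀ s₁ (limitFamily D) hs₁ hprob₁ hlim₁'
    have h2 := hS D a₀ b₀ happ₀ s₁ (limitFamily D) hs₁ hprob₁ hlim₁'
    have h3 := hB D a₀ b₀ happ₀ s₁ (limitFamily D) hs₁ hprob₁ hlim₁'
    filter_upwards [h1, h2, h3] with γ h1 h2 h3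
    exact ⟨h2, h1.1, h1.2.1, h1.2.2, h3⟩
  -- S3 + S6: the two subsequential limit laws coincide
  exact hU D a₀ b₀ happ₀ (hA D a₀ b₀ happ₀) s s₁ P' (limitFamily D) hs hs₁ hP' hprob₁ hlim hlim₁' hcarP' hcar₁

/-! ### The skeleton theorem: the six stubs imply the crux, BY NAME -/

/-- **`YBLimitExists` from the line `avoidance`** (kernel-checked, no `sorry` of its own). Conjunct (i) is
the PROVED `ybEndpoints_of_mem_Icc`. For (ii) take `P := limitFamily` (chordal by the LANDED chordality of
canonical subsequential limits); given an admissible family `(u, a, b)` of `D`, pick a canonical endpoint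
approximation `(a₀, b₀)` of `D`, get `TendstoLaw` of the canonical family (`tendstoLaw_canonical`: S1, S3–S6
and S2 between canonical families), view it with the shift `u ≡ 0`, and add the coupling S2 between
`(u, a, b)` and `(0, a₀, b₀)`. Hypotheses = the six stubs under their registered names. -/
theorem YBLimitExists_of (h₁ : __Registered.stub_canonicalTight) (h₂ : __Registered.stub_shiftEndpointCoupling)
    (h₃ : __Registered.stub_avoidanceCocycleLimit) (h₄ : __Registered.stub_subseqLimitSimple)
    (h₅ : __Registered.stub_subseqLimitBoundary) (h₆ : __Registered.stub_uniqueOfAvoidance) :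
    Summit.CriticalPhenomena.SAWScalingLimit.Theses.SAWTrackTransport.YBLimitExists := by
  refine And.intro Summit.CriticalPhenomena.SAWScalingLimit.Cruxes.HexTransfer.YbRelay.ybEndpoints_of_mem_Icc
    ⟨limitFamily, isChordal_limitFamily, ?_⟩
  intro D u a b hu hne ha hb
  -- a canonical endpoint approximation of `D` at `π/2`
  obtain ⟨a₀, b₀, happ₀⟩ :=
    Summit.CriticalPhenomena.SAWScalingLimit.Cruxes.HexTransfer.YbRelay.ybEndpoints_of_mem_Icc
      (Real.pi / 2) pi_div_two_mem_Icc D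
  -- the canonical family converges to `limitFamily D`; view it with the shift `u ≡ 0`
  have hcan := tendstoLaw_transport (carrier_shift_zero D).symm (tendstoLaw_canonical h₁ h₂ h₃ h₄ h₅ h₆ D happ₀)
  -- the coupling between `(u, a, b)` and `(0, a₀, b₀)`
  have hcoup := h₂ D u (fun _ : ℝ => (0 : ℂ)) a b a₀ b₀ hu hne ha hb eventually_norm_zero_le
    (nonempty_transport (carrier_shift_zero D).symm happ₀.nonempty) happ₀.tendsto_fst happ₀.tendsto_snd
  intro f
  have hsum := (hcoup f).add (hcan f)
  rw [zero_add] at hsum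
  exact hsum.congr fun δ => sub_add_cancel _ _

/-- Wiring check (an `example`, so that `YBLimitExists_of` stays the only theorem concluding the crux). -/
example : Summit.CriticalPhenomena.SAWScalingLimit.Theses.SAWTrackTransport.YBLimitExists :=
  YBLimitExists_of stub_canonicalTight stub_shiftEndpointCoupling stub_avoidanceCocycleLimit
    stub_subseqLimitSimple stub_subseqLimitBoundary stub_uniqueOfAvoidance

end Summit.CriticalPhenomena.SAWScalingLimit.Cruxes.YBLimitExists.Avoidance

end
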